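import Mathlib
import HarnessLib
import Summits.HubbardSuperconductivity.HubbardSuperconductivity.Theorems.KLProgrammeKLRegimeEnginePairTransferBaseScaleZeroData
import Summits.HubbardSuperconductivity.HubbardSuperconductivity.Theorems.KLProgrammeKLRegimeEngineScaleZeroSmearingMemberDiff

/-!
# Route `KLProgramme` — ENGINE child (stmt-HubbardSuperconductivity-20437 `KLRegimeEngineV17F2`), class #5 base row at scale `0`:
# **`klmf_baseData_of_scaleZero_secondOrder`** — k3c1-p1 g14's `klmf_baseData_of_scaleZero` RE-KEYED to the second-order member bound (cure (β) of the located
# «(X).2′-BASE-ROOM» / «SCALE0-MEMBER-DIFF», cell gate-hubbard-kl, seat hubbard-kl-k3c5-p1 g22)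

WHY.  `klmf_baseData_of_scaleZero` (✓, `…PairTransferBaseScaleZeroData`) produces the BASE existential of the class-#5 producer «95v2» (rows 26/26b/51, clause `hbase`) from
the two a priori member rows and ONE scalar inequality `(4/6047)·ms·(klTransferC R·U²) + 4·mA²·ms ≤ θ·r·(KlamU)²·ms` (`ms = klIdxMass 0 j′`), which k3c1-p1 g23 showed to be
UNSATISFIABLE for every admissible `P` with `klCTcap8·Klam² < 2⁹³` (✓ p731331 `klTransferC_ge_two_pow`, `klmx_base_scalar_false_of_lt`): `U`-homogeneous, so no smallness of `U`
helps.  With `EngineV8.norm_klCovSmearedPairAmplitude_member_sub_le_secondOrder` (✓ `…EngineScaleZeroSmearingMemberDiff`, parts F1–F5) the SAME existential follows from the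
U-INHOMOGENEOUS scalar inequality
`(160·ms·U² + (2²⁰/12108³)·klScaleZeroCV R·klScaleZeroThetaC R²·ms·U³) + 4·mA²·ms ≤ θ·r·(KlamU)²·ms`,
i.e. (dividing by `ms·U² > 0`) `160 + (2²⁰/12108³)·CV·ThetaC²·U + 4·(mA/U)² ≤ θ·r·Klam²` — satisfiable for `U ≤ U₀(P,R)` as soon as `160 + 4(mA/U)² < θ·r·Klam²`
(e.g. `θ = 1/5`, `r = klCTcap8 ≥ 2²⁰`, `Klam ≥ 1`).  Everything else (hypotheses, conclusion) is `klmf_baseData_of_scaleZero` VERBATIM, so the class-#5 spine re-keys by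
replacing one lemma name and one number row.  Plumbing; nothing about the model is asserted beyond the landed estimates; nothing asserts (X).2′/(X).3, row (c), any stub,
K3, U₀ or superconductivity.  0 kit · 0 lit.
-/

noncomputable section

namespace Summit.HubbardSuperconductivity.HubbardSuperconductivity.Theorems.KLRegimeSplit

set_option linter.dupNamespace false -- summit = problem name (single-conjunct summit), D-0017

open Real Finset Matrix Set Literature.MathematicalPhysics.QuantumLattice Literature.Probability.LatticeModels GrassmannAlgebra
open Summit.HubbardSuperconductivity.HubbardSuperconductivity.Theorems.KLProgrammeCooperResummation
open Summit.HubbardSuperconductivity.HubbardSuperconductivity.Theorems.KLProgrammeLegKernels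
open Summit.HubbardSuperconductivity.HubbardSuperconductivity.Theorems.DispersionFlow
open Summit.HubbardSuperconductivity.HubbardSuperconductivity.Theorems.KLRegimeWick
open Summit.HubbardSuperconductivity.HubbardSuperconductivity.Theorems.EngineV8
open Summit.HubbardSuperconductivity.HubbardSuperconductivity.Theorems.ScaleZeroDecay

section Base

variable (L M : ℕ) [NeZero L] [NeZero M]

/-- **`klmf_baseData_of_scaleZero_secondOrder`** — the BASE existential of rows 26/26b/51 (`pairTransferStep7_of_analytic(_gridNorms)`, clause `hbase`) at the bar
`θ·transferBarRelIdx L G P r β U 0 j′`, CLOSED at scale `0` from `R.WF`, `0 < U ≤ 1`, `FrameOK` (bare frame `K₀ = klFlowFrameU … 0`), `klBetaMin ≤ β ≤ L`, `β³ ≤ M`,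
`klScaleZeroThetaC R·U ≤ 1/4`, `j′ ≤ j`, the two a priori rows and the ONE U-inhomogeneous scalar inequality
`(160·klIdxMass 0 j′·U² + (2²⁰/12108³)·klScaleZeroCV R·klScaleZeroThetaC R²·klIdxMass 0 j′·U³) + 4·mA²·klIdxMass 0 j′ ≤ θ·r·(KlamU)²·klIdxMass 0 j′`
(`klmf_baseData_of_scaleZero` with the member difference read through explicit second order). -/
theorem klmf_baseData_of_scaleZero_secondOrder {R : RenConsts} (hRw : R.WF) {N₀ : ℕ} {G : GeoConsts} (hCF : 0 ≤ G.CF) {P : SplitConsts} (hKl : 0 ≤ P.Klam)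
    {r : ℝ} (hr : 0 ≤ r) {β U μ : ℝ} (hU : 0 < U) (hU1 : U ≤ 1) {mA θ : ℝ} (hm : 0 ≤ mA) (hθ0 : 0 ≤ θ)
    (hKf : FrameOK R U N₀ μ (klFlowFrameU L M β U μ 0)) (hβ : klBetaMin ≤ β) (hβL : β ≤ L) (hβM : β ^ 3 ≤ (M : ℝ)) (hθC : klScaleZeroThetaC R * U ≤ 1 / 4)
    {j j' : ℕ} (hj : j' ≤ j) (Qm : TorusSite 2 L)
    (hA₁ : ∀ x y, ‖klMemberArrayF L M β U μ 0 (softSymbolCompl L M β μ (klFlowFrameU L M β U μ 0) 0 j) Qm x y‖ ≤ mA)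
    (hA₂ : ∀ x y, ‖klMemberArrayF L M β U μ 0 (softSymbolCompl L M β μ (klFlowFrameU L M β U μ 0) 0 j') Qm x y‖ ≤ mA)
    (hbud : (160 * klIdxMass 0 j' * U ^ 2 + 2 ^ 20 / 12108 ^ 3 * klScaleZeroCV R * klScaleZeroThetaC R ^ 2 * klIdxMass 0 j' * U ^ 3) +
        4 * (mA * mA) * klIdxMass 0 j' ≤ θ * (r * ((P.Klam * U) ^ 2 * klIdxMass 0 j'))) :
    ∃ η : TorusSite 2 L → TorusSite 2 L → ℝ,
      (∀ x y, ‖klMemberArrayF L M β U μ 0 (softSymbolCompl L M β μ (klFlowFrameU L M β U μ 0) 0 j) Qm x y‖ ≤ mA) ∧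
      (∀ x y, ‖klMemberArrayF L M β U μ 0 (softSymbolCompl L M β μ (klFlowFrameU L M β U μ 0) 0 j') Qm x y‖ ≤ mA) ∧
      (∀ k ∈ klBall L μ 0, ∀ k' ∈ klBall L μ 0,
        ‖(klMemberArrayF L M β U μ 0 (softSymbolCompl L M β μ (klFlowFrameU L M β U μ 0) 0 j) Qm - klMemberArrayF L M β U μ 0 (softSymbolCompl L M β μ (klFlowFrameU L M β U μ 0) 0 j') Qm) k k'‖ ≤ η k k') ∧
      (∀ k ∈ klBall L μ 0, ∀ k' ∈ klBall L μ 0, η k k' + mA * mA *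
        ∑ c, ‖(-(((klTransferWeight L M β μ (klFlowFrameU L M β U μ 0) 0 (softSymbolCompl L M β μ (klFlowFrameU L M β U μ 0) 0 j) Qm c -
          klTransferWeight L M β μ (klFlowFrameU L M β U μ 0) 0 (softSymbolCompl L M β μ (klFlowFrameU L M β U μ 0) 0 j') Qm c : ℝ)) : ℂ))‖ ≤
        θ * transferBarRelIdx L G P r β U 0 j' Qm k k') := by
  refine ⟨fun _ _ => 160 * klIdxMass 0 j' * U ^ 2 + 2 ^ 20 / 12108 ^ 3 * klScaleZeroCV R * klScaleZeroThetaC R ^ 2 * klIdxMass 0 j' * U ^ 3, hA₁, hA₂,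
    fun k hk k' hk' => ?_, fun k hk k' hk' => ?_⟩
  · rw [Matrix.sub_apply, klMemberArrayF_apply_of_mem β U μ 0 _ Qm hk hk', klMemberArrayF_apply_of_mem β U μ 0 _ Qm hk hk']
    exact norm_klCovSmearedPairAmplitude_member_sub_le_secondOrder (L := L) (M := M) hRw hU hU1 hKf hβ hβL hβM hθC hj Qm k k'
  · have hw : ∑ c, ‖(-(((klTransferWeight L M β μ (klFlowFrameU L M β U μ 0) 0 (softSymbolCompl L M β μ (klFlowFrameU L M β U μ 0) 0 j) Qm c -
          klTransferWeight L M β μ (klFlowFrameU L M β U μ 0) 0 (softSymbolCompl L M β μ (klFlowFrameU L M β U μ 0) 0 j') Qm c : ℝ)) : ℂ))‖ ≤ 4 * klIdxMass 0 j' := by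
      have h := sum_abs_klTransferWeight_compl_sub_le (M := M) β μ (klFlowFrameU L M β U μ 0) hKf hβ hβL (Nat.zero_le j') hj Qm
      refine le_of_eq_of_le ?_ h
      refine Finset.sum_congr rfl fun c _ => ?_
      rw [norm_neg, Complex.norm_real, Real.norm_eq_abs]
    have hfl := transferBarRelIdx_floor_le (L := L) hCF hKl hr β U 0 j' Qm k k'
    rw [klIdxPrefactor_zero, pow_zero, inv_one, one_mul] at hfl
    have hmm : 0 ≤ mA * mA := mul_nonneg hm hm
    have h1 := mul_le_mul_of_nonneg_left hw hmm
    have h2 := mul_le_mul_of_nonneg_left hfl hθ0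
    linarith

end Base

end Summit.HubbardSuperconductivity.HubbardSuperconductivity.Theorems.KLRegimeSplit

end
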